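import Literature.NumberTheory.Weil1964.ArchWeilDatum
import Literature.Analysis.SegalBargmann.SchwartzChirpProductRule
import Literature.Analysis.SegalBargmann.HermiteGaussianSecondMoment
import Literature.LinearAlgebra.Matrix.RotationThreeShears
import Mathlib.Analysis.SpecialFunctions.ExpDeriv
import Mathlib.Analysis.Complex.RealDeriv
import HarnessLib

/-!
# The zero-point derivative of an archimedean Weil datum along a chirp–Weyl circle

Setting: an archimedean Weil datum `hW : IsArchWeilDatum ι𝕎 ω` (tree file `ArchWeilDatum`), a one-parameter
family `u : ℝ → G_∞` on which `ω` acts by the EXACT Siegel chirps `ω (u y) = chirpS (y • b)` (this is the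
conclusion of the tree's zero-point pin `IsArchWeilDatum.apply_eq_chirpS`, file `ArchWeilUnipotentPin`), an
element `w ∈ G_∞` having a Schwartz unit vector `φ₀` as eigenvector (`ω w φ₀ = c φ₀`, `|c| = 1`), and two real
reparametrisations `s, t` vanishing at `0`.  Consider the product element

  `k(θ) = (w · u(−t θ) · w⁻¹) · u(s θ) · (w · u(−t θ) · w⁻¹)`

(for the `SU(1,1)`-circle of the theta lane this is the factorisation `u₋(t) u₊(s) u₋(t)` of a rotation, with
`u₋(y) = w u₊(−y) w⁻¹`).  **Theorem (`hasDerivAt_eigenvalue_triple`)**: if `ω (k θ) φ₀ = χ(θ) φ₀` for `θ` near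
`0`, then `χ` is differentiable at `0` and

  `χ'(0) = (s'(0) − 2 t'(0)) · ⟪φ₀, X_b φ₀⟫`,   `X_b = chirpGen b = −πi (x·bx)`.

For the vacuum `φ₀ = h₀ = hermitePi 0` the tree's Gaussian second moment (`HermiteGaussianSecondMoment`) gives
`⟪h₀, X_b h₀⟫ = −πi · tr(b)/(4π)`, hence **`χ'(0) = −(i/4) (s'(0) − 2t'(0)) tr(b)`**
(`hasDerivAt_vacuumEigenvalue_triple`).  With a character `χ(θ) = e^{imθ}` of the circle this pins the
zero-point weight: `4m = −(s'(0) − 2t'(0)) tr(b)` (`vacuum_weight_pin`), and along an `SL₂`-homomorphism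
`φ : SL(2,ℝ) →* G_∞` with `u = φ ∘ U`, `w = φ(w)` and the three-shear factorisation of the rotation
(`RotationThreeShears`: `s = −sin`, `t = tan(·/2)`, `s' − 2t' = −2`) simply **`2m = tr(b)`**
(`two_mul_weight_eq_trace`; mirror form `two_mul_weight_eq_neg_trace`: `2m = −tr(b)` when the LOWER shears
`φ ∘ L` are the chirps) — the input the theta lane uses to decide the vacuum `det`-characters of the
`U(2,1) × U(1)` junction (design note `W2inf-zp-design.md` §5; the `SL₂ ↪ G_∞` instance is separate).

Everything is KERNEL-PROVED; no statement of print is used as a hypothesis.  References (provenance of the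
objects only): Folland 1989, Ch. 4 §2 (4.24)–(4.25), Prop. 4.27, Thm. 4.45; Lion–Vergne 1980, §1.6–1.8.
-/

noncomputable section

open MeasureTheory Complex SchwartzMap Filter Topology
open scoped InnerProductSpace ComplexConjugate Real

namespace Literature.NumberTheory.Weil1964

open Literature.Analysis.SegalBargmann Literature.RepresentationTheory.HeisenbergGroup Literature.LinearAlgebra.Matrix

variable {σ : Type*} [Fintype σ] [DecidableEq σ]
variable {Ginf : Type*} [Group Ginf] [TopologicalSpace Ginf]

local notation "L2R" σ => Lp ℂ 2 (volume : Measure (σ → ℝ))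
local notation "SR" σ => SchwartzMap (σ → ℝ) ℂ
local notation "PV" σ => (σ → ℝ) × (σ → ℝ)
local notation "SpR" σ => symplecticGroup (polar (dotPairing σ))

/-! ## 1. The chirp generator through the quadratic-form multiplier -/

omit [DecidableEq σ] in
/-- `X_b = −πi · (x·bx)`: the chirp generator is `−πi` times the quadratic-form multiplier `quadMulS b`.
[cite: Folland1989, Ch. 4 §2 (4.25)] -/
theorem chirpGen_eq_smul_quadMulS (b : (σ → ℝ) →ₗ[ℝ] (σ → ℝ)) (f : SR σ) :
    chirpGen b f = (-(π : ℂ) * I) • quadMulS b f := by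
  ext x
  rw [chirpGen_apply, smul_apply, smul_eq_mul, quadMulS_apply, chirpArg]
  push_cast
  ring

/-- **The vacuum zero-point number**: `⟪h₀, X_b h₀⟫ = −πi · tr(b)/(4π)`. [cite: Folland1989, §1.7, (4.25)] -/
theorem inner_toL2_hermitePi_zero_chirpGen (b : (σ → ℝ) →ₗ[ℝ] (σ → ℝ)) :
    ⟪(toL2 (hermitePi (0 : σ →₀ ℕ)) : L2R σ), toL2 (chirpGen b (hermitePi 0))⟫_ℂ =
      (-(π : ℂ) * I) * (((LinearMap.toMatrix' b).trace / (4 * π) : ℝ) : ℂ) := by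
  rw [chirpGen_eq_smul_quadMulS, map_smul, inner_smul_right, inner_toL2_hermitePi_zero_quadMulS]

namespace IsArchWeilDatum

variable {ι𝕎 : Ginf →* SpR σ} {ω : Representation ℂ Ginf (SR σ)}

/-! ## 2. Bookkeeping: unitary lift of one element, inverse, chirps -/

omit [DecidableEq σ] [TopologicalSpace Ginf] in
/-- `ω (a * b) f = ω a (ω b f)`. [folklore] -/
theorem rep_apply_mul (ω : Representation ℂ Ginf (SR σ)) (a b : Ginf) (f : SR σ) :
    ω (a * b) f = ω a (ω b f) := by
  rw [map_mul, Module.End.mul_apply]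

omit [DecidableEq σ] [TopologicalSpace Ginf] in
/-- `ω w⁻¹ (ω w f) = f` and `ω w (ω w⁻¹ f) = f`. [folklore] -/
theorem rep_apply_inv_apply (ω : Representation ℂ Ginf (SR σ)) (w : Ginf) (f : SR σ) :
    ω w (ω w⁻¹ f) = f := by
  rw [← rep_apply_mul, mul_inv_cancel, map_one, Module.End.one_apply]

omit [DecidableEq σ] [TopologicalSpace Ginf] in
/-- `ω w⁻¹ (ω w f) = f`. [folklore] -/
theorem rep_inv_apply_apply (ω : Representation ℂ Ginf (SR σ)) (w : Ginf) (f : SR σ) :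
    ω w⁻¹ (ω w f) = f := by
  rw [← rep_apply_mul, inv_mul_cancel, map_one, Module.End.one_apply]

omit [DecidableEq σ] [TopologicalSpace Ginf] in
/-- An eigenvector of `ω w` with nonzero eigenvalue `c` is an eigenvector of `ω w⁻¹` with eigenvalue `c⁻¹`.
[folklore] -/
theorem rep_inv_apply_of_eigen (ω : Representation ℂ Ginf (SR σ)) {w : Ginf} {φ₀ : SR σ} {c : ℂ} (hc : c ≠ 0)
    (hw : ω w φ₀ = c • φ₀) : ω w⁻¹ φ₀ = c⁻¹ • φ₀ := by
  have h := congrArg (ω w⁻¹) hw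
  rw [rep_inv_apply_apply, map_smul] at h
  calc ω w⁻¹ φ₀ = c⁻¹ • (c • ω w⁻¹ φ₀) := by rw [smul_smul, inv_mul_cancel₀ hc, one_smul]
    _ = c⁻¹ • φ₀ := by rw [← h]

omit [DecidableEq σ] [TopologicalSpace Ginf] in
/-- From a unitary lift `W` of `ω w` (field `exists_lift`): `toL2 (ω w f) = W (toL2 f)`. [folklore] -/
theorem toL2_apply_of_liftsTo {w : Ginf} {W : (L2R σ) ≃ₗᵢ[ℂ] L2R σ}
    (hWl : LiftsTo (ω w) ((W.toContinuousLinearEquiv : (L2R σ) ≃L[ℂ] L2R σ) : (L2R σ) →L[ℂ] L2R σ))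
    (f : SR σ) : toL2 (ω w f) = W (toL2 f) := by
  rw [hWl f]
  rfl

omit [DecidableEq σ] [TopologicalSpace Ginf] in
/-- … and `toL2 (ω w⁻¹ f) = W⁻¹ (toL2 f)`. [folklore] -/
theorem toL2_inv_apply_of_liftsTo {w : Ginf} {W : (L2R σ) ≃ₗᵢ[ℂ] L2R σ}
    (hWl : LiftsTo (ω w) ((W.toContinuousLinearEquiv : (L2R σ) ≃L[ℂ] L2R σ) : (L2R σ) →L[ℂ] L2R σ))
    (f : SR σ) : toL2 (ω w⁻¹ f) = W.symm (toL2 f) := by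
  have h := toL2_apply_of_liftsTo hWl (ω w⁻¹ f)
  rw [rep_apply_inv_apply] at h
  rw [h, LinearIsometryEquiv.symm_apply_apply]

/-! ## 3. The matrix coefficient of the triple product as a chirp triple -/

omit [DecidableEq σ] in
/-- `chirpS (y • b) (chirpS ((-y) • b) f) = f`. [folklore] -/
theorem chirpS_smul_chirpS_neg_smul (b : (σ → ℝ) →ₗ[ℝ] (σ → ℝ)) (y : ℝ) (f : SR σ) :
    chirpS (y • b) (chirpS ((-y) • b) f) = f := by
  show ((chirpS (y • b)).comp (chirpS ((-y) • b))) f = f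
  rw [← chirpS_add, ← add_smul, add_neg_cancel, zero_smul, chirpS_zero, ContinuousLinearMap.id_apply]

omit [DecidableEq σ] [TopologicalSpace Ginf] in
/-- **The triple-product matrix coefficient is a chirp triple.**  With `W` a unitary lift of `ω w`,
`g = ω w⁻¹ φ₀`, and `ω (u y) = chirpS (y • b)`:
`⟪φ₀, ω(w u(−t) w⁻¹ · u(s) · w u(−t) w⁻¹) φ₀⟫ = ⟪W M(t) g, M(s) W M(−t) g⟫` (`M(y) = chirpL2 (y • b)`).
[cite: Folland1989, Ch. 4 §2 (4.24)–(4.25)] -/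
theorem inner_apply_triple_eq (ω : Representation ℂ Ginf (SR σ)) {b : (σ → ℝ) →ₗ[ℝ] (σ → ℝ)} {u : ℝ → Ginf}
    (hu : ∀ (y : ℝ) (f : SR σ), ω (u y) f = chirpS (y • b) f) {w : Ginf} {W : (L2R σ) ≃ₗᵢ[ℂ] L2R σ}
    (hWl : LiftsTo (ω w) ((W.toContinuousLinearEquiv : (L2R σ) ≃L[ℂ] L2R σ) : (L2R σ) →L[ℂ] L2R σ))
    (φ₀ : SR σ) (s t : ℝ) :
    ⟪(toL2 φ₀ : L2R σ), toL2 (ω (w * u (-t) * w⁻¹ * u s * (w * u (-t) * w⁻¹)) φ₀)⟫_ℂ =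
      ⟪(W (toL2 (chirpS (t • b) (ω w⁻¹ φ₀))) : L2R σ),
        chirpL2 (s • b) (W (toL2 (chirpS ((-t) • b) (ω w⁻¹ φ₀))))⟫_ℂ := by
  -- unfold the action of the seven-letter word
  simp only [rep_apply_mul, hu]
  -- the outer `ω w` goes across the inner product as `W`
  rw [toL2_apply_of_liftsTo hWl, ← W.apply_symm_apply (toL2 φ₀), LinearIsometryEquiv.inner_map_map,
    ← toL2_inv_apply_of_liftsTo hWl]
  -- the outer `chirpS (-t • b)` goes across as `chirpS (t • b)`
  rw [toL2_chirpS ((-t) • b), ← (chirpL2 (t • b)).inner_map_map, ← toL2_chirpS, ← toL2_chirpS, ← toL2_chirpS,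
    chirpS_smul_chirpS_neg_smul]
  -- the inner `ω w⁻¹` goes across as `W`
  rw [toL2_inv_apply_of_liftsTo hWl, ← W.inner_map_map, W.apply_symm_apply, toL2_chirpS (s • b),
    toL2_apply_of_liftsTo hWl]

/-! ## 4. The zero-point derivative -/

omit [DecidableEq σ] in
/-- **Zero-point derivative along a chirp–Weyl triple.**  Let `hW : IsArchWeilDatum ι𝕎 ω`, `ω (u y) = chirpS (y • b)`
exactly, `ω w φ₀ = c • φ₀` with `‖c‖ = 1` for a Schwartz unit vector `φ₀` (`⟪φ₀, φ₀⟫ = 1`), and `s t : ℝ → ℝ`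
differentiable at `0` with `s 0 = t 0 = 0`.  If `φ₀` is an eigenvector of `ω (w u(−tθ) w⁻¹ · u(sθ) · w u(−tθ) w⁻¹)`
with eigenvalue `χ θ` for `θ` near `0`, then `χ'(0) = (s' − 2t') ⟪φ₀, X_b φ₀⟫`.
[cite: Folland1989, Ch. 4 §2 Prop. 4.27, Thm. 4.45] -/
theorem hasDerivAt_eigenvalue_triple (hW : IsArchWeilDatum ι𝕎 ω) {b : (σ → ℝ) →ₗ[ℝ] (σ → ℝ)} {u : ℝ → Ginf}
    (hu : ∀ (y : ℝ) (f : SR σ), ω (u y) f = chirpS (y • b) f) {w : Ginf} {φ₀ : SR σ} {c : ℂ} (hc : ‖c‖ = 1)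
    (hw : ω w φ₀ = c • φ₀) (hφ₀ : ⟪(toL2 φ₀ : L2R σ), toL2 φ₀⟫_ℂ = 1)
    {s t : ℝ → ℝ} {s' t' : ℝ} (hs : HasDerivAt s s' 0) (hs0 : s 0 = 0) (ht : HasDerivAt t t' 0) (ht0 : t 0 = 0)
    {χ : ℝ → ℂ}
    (hχ : ∀ᶠ θ in 𝓝 (0 : ℝ), ω (w * u (-t θ) * w⁻¹ * u (s θ) * (w * u (-t θ) * w⁻¹)) φ₀ = χ θ • φ₀) :
    HasDerivAt χ (((s' - 2 * t' : ℝ) : ℂ) * ⟪(toL2 φ₀ : L2R σ), toL2 (chirpGen b φ₀)⟫_ℂ) 0 := by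
  obtain ⟨W, hWl⟩ := hW.exists_lift w
  have hc0 : c ≠ 0 := by
    rintro rfl
    simp at hc
  set g : SR σ := ω w⁻¹ φ₀ with hg_def
  have hg : g = c⁻¹ • φ₀ := rep_inv_apply_of_eigen ω hc0 hw
  have hWg : W (toL2 g) = toL2 φ₀ := by
    rw [← toL2_apply_of_liftsTo hWl, hg_def, rep_apply_inv_apply]
  have hWXg : W (toL2 (chirpGen b g)) = toL2 (ω w (chirpGen b g)) := (toL2_apply_of_liftsTo hWl _).symm
  -- the chirp triple is differentiable at 0 with the three-term derivative
  have hD := hasDerivAt_inner_chirp_triple b W g φ₀ (ω w (chirpGen b g)) hWg hWXg hs hs0 ht ht0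
  -- identify the matrix coefficient with `χ`
  have hφχ : (fun θ : ℝ => ⟪(W (toL2 (chirpS ((t θ) • b) g)) : L2R σ),
      chirpL2 ((s θ) • b) (W (toL2 (chirpS ((-t θ) • b) g)))⟫_ℂ) =ᶠ[𝓝 0] χ := by
    filter_upwards [hχ] with θ hθ
    rw [hg_def, ← inner_apply_triple_eq ω hu hWl φ₀ (s θ) (t θ), hθ, map_smul, inner_smul_right, hφ₀, mul_one]
  have hχ' := hD.congr_of_eventuallyEq hφχ.symm
  refine hχ'.congr_deriv ?_
  -- evaluate the two `W`-terms through the eigen-relation and skew-symmetry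
  have hcc : (starRingEnd ℂ) c⁻¹ * c⁻¹ = 1 := by
    rw [← Complex.normSq_eq_conj_mul_self, Complex.normSq_eq_norm_sq, norm_inv, hc, inv_one, one_pow,
      Complex.ofReal_one]
  have h0 : ⟪(toL2 g : L2R σ), toL2 (chirpGen b g)⟫_ℂ = ⟪(toL2 φ₀ : L2R σ), toL2 (chirpGen b φ₀)⟫_ℂ := by
    rw [hg, map_smul, map_smul, map_smul, inner_smul_left, inner_smul_right, ← mul_assoc, hcc, one_mul]
  have h1 : ⟪(toL2 φ₀ : L2R σ), toL2 (ω w (chirpGen b g))⟫_ℂ = ⟪(toL2 φ₀ : L2R σ), toL2 (chirpGen b φ₀)⟫_ℂ := by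
    rw [toL2_apply_of_liftsTo hWl]
    conv_lhs => rw [← hWg]
    rw [W.inner_map_map, h0]
  have h2 : ⟪(toL2 (ω w (chirpGen b g)) : L2R σ), toL2 φ₀⟫_ℂ = -⟪(toL2 φ₀ : L2R σ), toL2 (chirpGen b φ₀)⟫_ℂ := by
    rw [toL2_apply_of_liftsTo hWl]
    conv_lhs => rw [← hWg]
    rw [W.inner_map_map, inner_toL2_chirpGen_left, h0]
  rw [h1, h2]
  push_cast
  ring

/-- **The vacuum zero-point derivative.**  In the setting of `hasDerivAt_eigenvalue_triple` with `φ₀ = h₀ = hermitePi 0`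
(Folland's normalised Gaussian): `χ'(0) = −πi (s' − 2t') · tr(b)/(4π) = −(i/4)(s' − 2t') tr(b)`.
For the rotation factorisation `s = −sin`, `t = tan(·/2)` (`s' − 2t' = −2`) this is `χ'(0) = (i/2) tr(b)`, i.e. a
circle character `e^{imθ}` along it has `m = tr(b)/2`. [cite: Folland1989, Ch. 4 §2 Prop. 4.27, Thm. 4.45; §1.7] -/
theorem hasDerivAt_vacuumEigenvalue_triple (hW : IsArchWeilDatum ι𝕎 ω) {b : (σ → ℝ) →ₗ[ℝ] (σ → ℝ)}
    {u : ℝ → Ginf} (hu : ∀ (y : ℝ) (f : SR σ), ω (u y) f = chirpS (y • b) f) {w : Ginf} {c : ℂ}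
    (hc : ‖c‖ = 1) (hw : ω w (hermitePi 0) = c • hermitePi 0)
    {s t : ℝ → ℝ} {s' t' : ℝ} (hs : HasDerivAt s s' 0) (hs0 : s 0 = 0) (ht : HasDerivAt t t' 0) (ht0 : t 0 = 0)
    {χ : ℝ → ℂ}
    (hχ : ∀ᶠ θ in 𝓝 (0 : ℝ),
      ω (w * u (-t θ) * w⁻¹ * u (s θ) * (w * u (-t θ) * w⁻¹)) (hermitePi 0) = χ θ • hermitePi 0) :
    HasDerivAt χ (((s' - 2 * t' : ℝ) : ℂ) *
      ((-(π : ℂ) * I) * (((LinearMap.toMatrix' b).trace / (4 * π) : ℝ) : ℂ))) 0 := by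
  rw [← inner_toL2_hermitePi_zero_chirpGen]
  exact hasDerivAt_eigenvalue_triple hW hu hc hw inner_toL2_hermitePi_zero_self hs hs0 ht ht0 hχ

/-- calculus: `θ ↦ e^{imθ}` has derivative `im` at `0`. [folklore] -/
theorem hasDerivAt_cexp_I_mul_zero (m : ℂ) :
    HasDerivAt (fun θ : ℝ => cexp (I * m * (θ : ℂ))) (I * m) 0 := by
  have h : HasDerivAt (fun z : ℂ => cexp (I * m * z)) (cexp (I * m * ((0 : ℝ) : ℂ)) * (I * m * 1))
      ((0 : ℝ) : ℂ) := ((hasDerivAt_id ((0 : ℝ) : ℂ)).const_mul (I * m)).cexp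
  rw [Complex.ofReal_zero, mul_zero, Complex.exp_zero, one_mul, mul_one] at h
  exact h.comp_ofReal

/-- the value of the vacuum zero-point derivative, normalised: `(s' − 2t')·(−πi)·(T/(4π)) = i · (−(s' − 2t') T / 4)`.
[folklore] -/
theorem vacuumDerivValue_eq (s' t' T : ℝ) :
    ((s' - 2 * t' : ℝ) : ℂ) * ((-(π : ℂ) * I) * ((T / (4 * π) : ℝ) : ℂ)) =
      I * ((-(s' - 2 * t') * T / 4 : ℝ) : ℂ) := by
  have hπ : (π : ℂ) ≠ 0 := Complex.ofReal_ne_zero.mpr Real.pi_ne_zero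
  push_cast
  field_simp

/-- **The integer pin.**  If, in the setting of `hasDerivAt_vacuumEigenvalue_triple`, the vacuum transforms along the
word by an honest circle character `θ ↦ e^{imθ}` (`m : ℤ`, e.g. a torus weight read through a determinant-power
character), then `4m = −(s' − 2t') · tr(b)`; for the rotation factorisation (`s' − 2t' = −2`): `m = tr(b)/2`.
This is the consistency constraint an SU(1,1)-circle imposes on vacuum exponents of ANY archimedean Weil datum.
[cite: Folland1989, Ch. 4 §2 Prop. 4.27, Thm. 4.45; §1.7] -/
theorem vacuum_weight_pin (hW : IsArchWeilDatum ι𝕎 ω) {b : (σ → ℝ) →ₗ[ℝ] (σ → ℝ)}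
    {u : ℝ → Ginf} (hu : ∀ (y : ℝ) (f : SR σ), ω (u y) f = chirpS (y • b) f) {w : Ginf} {c : ℂ}
    (hc : ‖c‖ = 1) (hw : ω w (hermitePi 0) = c • hermitePi 0)
    {s t : ℝ → ℝ} {s' t' : ℝ} (hs : HasDerivAt s s' 0) (hs0 : s 0 = 0) (ht : HasDerivAt t t' 0) (ht0 : t 0 = 0)
    (m : ℤ)
    (hχ : ∀ᶠ θ in 𝓝 (0 : ℝ),
      ω (w * u (-t θ) * w⁻¹ * u (s θ) * (w * u (-t θ) * w⁻¹)) (hermitePi 0) =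
        cexp (I * (m : ℂ) * (θ : ℂ)) • hermitePi 0) :
    (4 : ℝ) * m = -(s' - 2 * t') * (LinearMap.toMatrix' b).trace := by
  have h1 := hasDerivAt_vacuumEigenvalue_triple hW hu hc hw hs hs0 ht ht0 hχ
  rw [vacuumDerivValue_eq] at h1
  have h2 := (hasDerivAt_cexp_I_mul_zero (m : ℂ)).unique h1
  have h3 : ((m : ℝ) : ℂ) = ((-(s' - 2 * t') * (LinearMap.toMatrix' b).trace / 4 : ℝ) : ℂ) := by
    rw [← mul_left_cancel₀ Complex.I_ne_zero h2]; norm_cast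
  have h4 : (m : ℝ) = -(s' - 2 * t') * (LinearMap.toMatrix' b).trace / 4 := by exact_mod_cast h3
  rw [h4]; ring

/-! ## 5. Along an `SL₂`-triple: `2m = tr(b)` -/

/-- **The vacuum weight along an `SL₂`-circle.**  Let `φ : SL(2,ℝ) →* Ginf` be a homomorphism whose upper
unipotents act in `ω` by the chirps of direction `b` (`ω (φ U(y)) = chirpS (y • b)` — zp1's conclusion) and whose
Weyl element `φ w` has the vacuum as an eigenvector; if the rotation circle `φ R(θ)` acts on the vacuum by `e^{imθ}`
near `θ = 0` (`m : ℤ`), then `2m = tr(b)`.  (Paeth word `R(θ) = w U(−tan θ/2) w⁻¹ · U(−sin θ) · w U(−tan θ/2) w⁻¹`,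
`s' − 2t' = −2`, and `vacuum_weight_pin`.) [cite: Folland1989, Ch. 4 §2 Prop. 4.27, Thm. 4.45; §1.7] -/
theorem two_mul_weight_eq_trace (hW : IsArchWeilDatum ι𝕎 ω) {b : (σ → ℝ) →ₗ[ℝ] (σ → ℝ)}
    (φ : Matrix.SpecialLinearGroup (Fin 2) ℝ →* Ginf)
    (hu : ∀ (y : ℝ) (f : SR σ), ω (φ (RotationThreeShears.slUpper y)) f = chirpS (y • b) f) {c : ℂ}
    (hc : ‖c‖ = 1) (hw : ω (φ RotationThreeShears.slWeyl) (hermitePi 0) = c • hermitePi 0) (m : ℤ)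
    (hχ : ∀ᶠ θ in 𝓝 (0 : ℝ),
      ω (φ (RotationThreeShears.slRot θ)) (hermitePi 0) = cexp (I * (m : ℂ) * (θ : ℂ)) • hermitePi 0) :
    (2 : ℝ) * m = (LinearMap.toMatrix' b).trace := by
  have hχ' : ∀ᶠ θ in 𝓝 (0 : ℝ),
      ω (φ RotationThreeShears.slWeyl * φ (RotationThreeShears.slUpper (-Real.tan (θ / 2))) *
          (φ RotationThreeShears.slWeyl)⁻¹ * φ (RotationThreeShears.slUpper (-Real.sin θ)) *
          (φ RotationThreeShears.slWeyl * φ (RotationThreeShears.slUpper (-Real.tan (θ / 2))) *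
            (φ RotationThreeShears.slWeyl)⁻¹)) (hermitePi 0) =
        cexp (I * (m : ℂ) * (θ : ℂ)) • hermitePi 0 := by
    filter_upwards [RotationThreeShears.eventually_map_slRot_eq_word φ, hχ] with θ h1 h2
    rw [← h1]
    exact h2
  have h := vacuum_weight_pin hW (u := fun y => φ (RotationThreeShears.slUpper y))
    (s := fun θ => -Real.sin θ) (t := fun θ => Real.tan (θ / 2)) hu hc hw
    RotationThreeShears.hasDerivAt_neg_sin_zero RotationThreeShears.neg_sin_zero
    RotationThreeShears.hasDerivAt_tan_half_zero RotationThreeShears.tan_half_zero m hχ'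
  linarith

/-- **Mirror form (lower shears chirp).**  Same as `two_mul_weight_eq_trace` when it is the LOWER unipotents
`φ L(y)` that act by the chirps of direction `b` (the case of the literal real-matrix embedding
`SL₂(ℝ) ⊂ U(1,1)` in a Lagrangian polarisation): then `2m = −tr(b)` (mirror Paeth word
`R(θ) = w⁻¹ L(tan θ/2) w · L(sin θ) · w⁻¹ L(tan θ/2) w`, `s' − 2t' = 2`). [cite: Folland1989, Ch. 4 §2 Prop. 4.27, Thm. 4.45; §1.7] -/
theorem two_mul_weight_eq_neg_trace (hW : IsArchWeilDatum ι𝕎 ω) {b : (σ → ℝ) →ₗ[ℝ] (σ → ℝ)}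
    (φ : Matrix.SpecialLinearGroup (Fin 2) ℝ →* Ginf)
    (hu : ∀ (y : ℝ) (f : SR σ), ω (φ (RotationThreeShears.slLower y)) f = chirpS (y • b) f) {c : ℂ}
    (hc : ‖c‖ = 1) (hw : ω (φ RotationThreeShears.slWeyl) (hermitePi 0) = c • hermitePi 0) (m : ℤ)
    (hχ : ∀ᶠ θ in 𝓝 (0 : ℝ),
      ω (φ (RotationThreeShears.slRot θ)) (hermitePi 0) = cexp (I * (m : ℂ) * (θ : ℂ)) • hermitePi 0) :
    (2 : ℝ) * m = -(LinearMap.toMatrix' b).trace := by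
  have hc0 : c ≠ 0 := by rintro rfl; simp at hc
  have hc' : ‖c⁻¹‖ = 1 := by rw [norm_inv, hc, inv_one]
  have hw' : ω (φ RotationThreeShears.slWeyl⁻¹) (hermitePi 0) = c⁻¹ • hermitePi 0 := by
    rw [map_inv]
    exact rep_inv_apply_of_eigen ω hc0 hw
  have hχ' : ∀ᶠ θ in 𝓝 (0 : ℝ),
      ω (φ RotationThreeShears.slWeyl⁻¹ * φ (RotationThreeShears.slLower (-(-Real.tan (θ / 2)))) *
          (φ RotationThreeShears.slWeyl⁻¹)⁻¹ * φ (RotationThreeShears.slLower (Real.sin θ)) *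
          (φ RotationThreeShears.slWeyl⁻¹ * φ (RotationThreeShears.slLower (-(-Real.tan (θ / 2)))) *
            (φ RotationThreeShears.slWeyl⁻¹)⁻¹)) (hermitePi 0) =
        cexp (I * (m : ℂ) * (θ : ℂ)) • hermitePi 0 := by
    filter_upwards [RotationThreeShears.eventually_map_slRot_eq_word' φ, hχ] with θ h1 h2
    rw [neg_neg, ← h1]
    exact h2
  have h := vacuum_weight_pin hW (u := fun y => φ (RotationThreeShears.slLower y))
    (w := φ RotationThreeShears.slWeyl⁻¹)
    (s := fun θ => Real.sin θ) (t := fun θ => -Real.tan (θ / 2)) hu hc' hw'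
    RotationThreeShears.hasDerivAt_sin_zero' Real.sin_zero
    RotationThreeShears.hasDerivAt_neg_tan_half_zero RotationThreeShears.neg_tan_half_zero m hχ'
  linarith

end IsArchWeilDatum

end Literature.NumberTheory.Weil1964
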